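import Summits.HodgeConjecture.HodgeConjecture.Theorems.F0P2pJacquetConstituentLemmas
import Summits.HodgeConjecture.HodgeConjecture.Theorems.F0P2pEigenlineFunctionals
import HarnessLib

/-!
# Crux `H413`, pay-down of the K1w letter — file 3/4: `JH(i(wχ)) ⊆ JH(i(χ))` in rank one, generically

Cell hodgecm-mathlib (D-0151), FLOOR 0, crux item H413 = stmt-HodgeConjecture-24833; K1 sub-line `Lines/F0_P2GR91NJacquetK1.lean` (v3a),
letter ★ `Rogawski1990.cmPrincipalSeries_isConstituentOf_weylConj`.  HC_CM is proved only modulo the 2 remaining named inputs (hLiu418,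
h413) until rung 0 closes; nothing here proves HC_CM.

THIS FILE (generic: a group `G`, a parabolic triple `t = (P, M, N)` with `M` COMMUTATIVE, `δ_P|_N = 1`, `N` a limit of compact open
subgroups; theorems only).  Casselman's rank-one bookkeeping [Casselman1995, §7.1] for two characters `χ ≠ χ'` of `M` such that
* `r_P i(χ)` is 2-dimensional with a `χ'`-line and quotient character `χ`, and `r_P i(χ')` is 2-dimensional with a `χ`-line and quotient `χ'`
  (the GEOMETRIC LEMMA, [BernsteinZelevinsky1977, 2.12]; for `U(3)` the booked letter ★ `U3PrincipalSeriesJacquetFiltration`), and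
* no constituent of `i(χ')` has zero Jacquet module ([Casselman1995, Thm. 6.3.5]; for `U(3)` from the booked letter ★
  `u3_isSupercuspidal_iff_jacquet_eq_zero` + ★ projectivity, file 1/3 §4):
§1 `subsingleton_coinvariants_quotient_of_map_eq` (two nested subrepresentations with the same image in the Jacquet module have a
subquotient with ZERO Jacquet module — exactness), `isConstituentOf_of_comp_eq_zero` (the constituent chase below); §2 the THEOREM
`isConstituentOf_of_weylData` (abstract `I, I'` with Frobenius ∕ evaluation inputs as hypotheses — so that consumers instantiate it syntactically at their own
spelling of the principal series) and its instance `isConstituentOf_normalizedInd_of_weylData`: every constituent of `i(χ')` is a constituent of `i(χ)`.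
Proof: the eigen-line functionals of file 2/4 and Frobenius (file 1/4 §5) give non-zero `A : i(χ) → i(χ')`, `B : i(χ') → i(χ)` with `BA`, `AB` scalar; either `B` is injective
(★ `IsConstituentOf.of_injective`), or `AB = BA = 0`, `im A ≤ ker B` have the same one-dimensional image in `r_P i(χ')` (evaluation at
one, file 1/3 §2; `dim r_P i(χ') = 2`), so `ker B ⁄ im A` has zero Jacquet module (exactness, ★ `jacquetMap_injective`), and the exchange
lemmas (★ `IsConstituentOf.ker_or_of_intertwiningMap`, ★ `toRepresentation_or_quotientRep`) leave a constituent of `i(χ')` in `im A ≅ i(χ)⁄ker A`,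
in `i(χ')⁄ker B ↪ i(χ)`, or in `ker B ⁄ im A` — the last excluded by the no-zero-Jacquet hypothesis (file 1/3 §1).
«If `i_G(χ)` is reducible … `i_G(χ)` and `i_G(wχ)` have the same sets of constituents» [Rogawski1990, §12.2 p. 174].

## References
* [Casselman1995] §7.1 (L. 7.1.1, Cor. 7.1.2), Thm. 3.2.4, Thm. 6.3.5.  * [BernsteinZelevinsky1977] Prop. 1.9, §2.12, Thm. 2.9.
* [Rogawski1990] §12.2 p. 173–174.
-/

set_option autoImplicit false
-- the mandated namespace has the single-problem summit's repeated segment (`HodgeConjecture.HodgeConjecture`)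
set_option linter.dupNamespace false

noncomputable section

open Literature.NumberTheory.Automorphic Literature.RepresentationTheory.FiniteGroups
open Literature.RepresentationTheory.Semisimple

namespace Summit.HodgeConjecture.HodgeConjecture.Cruxes.H413.F0P2pWeylConstituentsRankOne

universe u

open F0P2pEigenlineFunctionals

/-! ## §1 Exactness bookkeeping and the constituent chase -/

section Main

variable {G : Type u} [Group G] [TopologicalSpace G] [IsTopologicalGroup G] (t : ParabolicTriple G) [LocallyCompactSpace t.P]

omit [LocallyCompactSpace t.P] in
/-- **Equal images in the Jacquet module ⇒ the subquotient has ZERO Jacquet module.**  For subrepresentations `F₁ ≤ F₂` of a smooth `ρ`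
(`N` a limit of compact open subgroups) whose images in `ρ_N` coincide, the quotient `F₂ ⁄ F₁` has `(F₂ ⁄ F₁)_N = 0`: by left exactness
`(F₂)_N ↪ ρ_N` (★ `jacquetMap_injective`), so `(F₁)_N → (F₂)_N` is onto, and `(F₂)_N ↠ (F₂ ⁄ F₁)_N` kills its image (right exactness).
[cite: BernsteinZelevinsky1977, Prop. 1.9 (a)] [cite: Casselman1995, Prop. 3.2.3] -/
theorem subsingleton_coinvariants_quotient_of_map_eq (hN : IsLimitOfCompactOpen t.N)
    {V : Type*} [AddCommGroup V] [Module ℂ V] {ρ : Representation ℂ G V} (hρ : ρ.IsSmooth)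
    (F₁ F₂ : Subrepresentation ρ) (hle : F₁ ≤ F₂)
    (heq : F₁.toSubmodule.map (Representation.Coinvariants.mk (t.restrict ρ)) =
      F₂.toSubmodule.map (Representation.Coinvariants.mk (t.restrict ρ))) :
    Subsingleton (t.restrict (Subrepresentation.quotientRep (ρ := F₂.toRepresentation)
      ⟨F₁.toSubmodule.comap F₂.toSubmodule.subtype, fun g _ hx ↦ F₁.apply_mem_toSubmodule g hx⟩)).Coinvariants := by
  set F₁' : Subrepresentation F₂.toRepresentation :=
    ⟨F₁.toSubmodule.comap F₂.toSubmodule.subtype, fun g _ hx ↦ F₁.apply_mem_toSubmodule g hx⟩ with hF₁'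
  -- `(F₁)_N → (F₂)_N` is onto
  have hsurj : Function.Surjective (Representation.jacquetMap t (Subrepresentation.subtypeIntertwiningMap F₁')) := by
    intro y
    obtain ⟨g, rfl⟩ := Representation.Coinvariants.mk_surjective _ y
    have hj : Representation.Coinvariants.mk (t.restrict ρ) (g : V) ∈
        F₂.toSubmodule.map (Representation.Coinvariants.mk (t.restrict ρ)) := ⟨g, g.2, rfl⟩
    rw [← heq] at hj
    obtain ⟨f, hf₁, hfeq⟩ := Submodule.mem_map.1 hj
    refine ⟨Representation.Coinvariants.mk _ ⟨⟨f, hle hf₁⟩, hf₁⟩, ?_⟩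
    apply Representation.jacquetMap_injective t hN hρ (Subrepresentation.subtypeIntertwiningMap F₂)
      (Subrepresentation.subtypeIntertwiningMap_injective F₂)
    rw [Representation.jacquetMap_mk, Representation.jacquetMap_mk, Representation.jacquetMap_mk]
    exact hfeq
  -- `(F₂)_N ↠ (F₂ ⁄ F₁)_N` kills the image of `(F₁)_N`
  refine ⟨fun x y => ?_⟩
  obtain ⟨x', rfl⟩ := Representation.jacquetMap_surjective t F₁'.mkQ F₁'.mkQ_surjective x
  obtain ⟨y', rfl⟩ := Representation.jacquetMap_surjective t F₁'.mkQ F₁'.mkQ_surjective y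
  obtain ⟨x'', rfl⟩ := hsurj x'
  obtain ⟨y'', rfl⟩ := hsurj y'
  obtain ⟨u, rfl⟩ := Representation.Coinvariants.mk_surjective _ x''
  obtain ⟨u', rfl⟩ := Representation.Coinvariants.mk_surjective _ y''
  simp only [Representation.jacquetMap_mk]
  rw [show F₁'.mkQ (Subrepresentation.subtypeIntertwiningMap F₁' u) = 0 from (F₁'.mkQ_eq_zero_iff _).2 u.2,
    show F₁'.mkQ (Subrepresentation.subtypeIntertwiningMap F₁' u') = 0 from (F₁'.mkQ_eq_zero_iff _).2 u'.2]

omit [LocallyCompactSpace t.P] in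
/-- **The constituent chase.**  Let `A : ρ → σ`, `B : σ → ρ` be intertwining maps with `B ∘ A = 0` and suppose the subquotient
`ker B ⁄ im A` of `σ` has zero Jacquet module while no constituent of `σ` has zero Jacquet module (`σ` smooth, `N` a limit of compact
open subgroups).  Then every constituent of `σ` is a constituent of `ρ`: by the exchange lemmas (★ `IsConstituentOf.ker_or_of_intertwiningMap`,
★ `toRepresentation_or_quotientRep`) it lives in `σ ⁄ ker B ↪ ρ`, in `im A ≅ ρ ⁄ ker A`, or in `ker B ⁄ im A` — excluded.
[cite: Casselman1995, §7.1 Cor. 7.1.2] [cite: BernsteinZelevinsky1977, Thm. 2.9] -/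
theorem isConstituentOf_of_comp_eq_zero (hN : IsLimitOfCompactOpen t.N)
    {V W : Type*} [AddCommGroup V] [Module ℂ V] [AddCommGroup W] [Module ℂ W]
    {ρ : Representation ℂ G V} {σ : Representation ℂ G W} (hσ : σ.IsSmooth)
    (A : ρ.IntertwiningMap σ) (B : σ.IntertwiningMap ρ)
    (hQ : Subsingleton (t.restrict (Subrepresentation.quotientRep (ρ := B.ker.toRepresentation)
      ⟨A.range.toSubmodule.comap B.ker.toSubmodule.subtype, fun g _ hx ↦ A.range.apply_mem_toSubmodule g hx⟩)).Coinvariants)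
    (hNC : ∀ r : SmoothIrrep G, (IrrClass.mk r).IsConstituentOf σ → Subsingleton (t.restrict r.ρ).Coinvariants → False)
    {c : IrrClass G} (hc : c.IsConstituentOf σ) : c.IsConstituentOf ρ := by
  set F₁' : Subrepresentation B.ker.toRepresentation :=
    ⟨A.range.toSubmodule.comap B.ker.toSubmodule.subtype, fun g _ hx ↦ A.range.apply_mem_toSubmodule g hx⟩ with hF₁'
  rcases hc.ker_or_of_intertwiningMap B with hker | hdone
  · rcases hker.toRepresentation_or_quotientRep F₁' with hF₁ | hQ'
    · -- inside `im A`, a quotient of `ρ`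
      let ι : F₁'.toRepresentation.IntertwiningMap A.range.toRepresentation :=
        ⟨{ toFun := fun x => ⟨((x : ↥B.ker.toSubmodule) : W), x.2⟩
           map_add' := fun _ _ => rfl
           map_smul' := fun _ _ => rfl }, fun g => rfl⟩
      have hι : Function.Injective ι := fun x y h =>
        Subtype.ext (Subtype.ext (congrArg (fun z : ↥A.range.toSubmodule => (z : W)) h))
      let Ar : ρ.IntertwiningMap A.range.toRepresentation :=
        ⟨LinearMap.codRestrict A.range.toSubmodule A.toLinearMap (fun v => ⟨v, rfl⟩),
          fun g => LinearMap.ext fun v => Subtype.ext (Representation.IntertwiningMap.isIntertwining _ _ A g v)⟩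
      have hAr : Function.Surjective Ar := by
        rintro ⟨w, v, rfl⟩
        exact ⟨v, rfl⟩
      exact (hF₁.of_injective ι hι).of_surjective Ar hAr
    · -- inside `ker B ⁄ im A`: zero Jacquet module — excluded
      exfalso
      obtain ⟨r, rfl⟩ := IrrClass.mk_surjective c
      exact hNC r hc (F0P2pJacquetConstituentLemmas.subsingleton_coinvariants_of_isConstituentOf t
        ((hσ.toRepresentation B.ker).quotientRep F₁') hN hQ r hQ')
  · exact hdone

/-! ## §2 The theorem, over an abstract pair of representations `I, I'` -/

omit [TopologicalSpace G] [IsTopologicalGroup G] [LocallyCompactSpace t.P] in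
/-- A representation with a non-trivial Jacquet module is non-trivial, so its identity map is non-zero. [folklore] -/
theorem id_ne_zero_of_nontrivial_coinvariants {V : Type*} [AddCommGroup V] [Module ℂ V] (I : Representation ℂ G V)
    (hX : Nontrivial (t.restrict I).Coinvariants) : Representation.IntertwiningMap.id I ≠ 0 := by
  haveI : Nontrivial V := by
    by_contra h
    rw [not_nontrivial_iff_subsingleton] at h
    exact not_subsingleton _ ((Representation.Coinvariants.mk_surjective (t.restrict I)).subsingleton)
  obtain ⟨v, hv⟩ := exists_ne (0 : V)
  intro h
  apply hv
  have := congrArg (fun f : Representation.IntertwiningMap I I => f v) h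
  simpa using this

set_option maxHeartbeats 800000 in
/-- **THE RANK-ONE WEYL THEOREM, abstract form (one inclusion): every constituent of `I'` is a constituent of `I`.**  Here `I`, `I'` (the latter smooth) are any two
representations standing for `i(χ)`, `i(χ')` (`χ ≠ χ'` characters of the commutative Levi `M` of `t = (P, M, N)`, `N` a limit of compact open
subgroups) together with exactly the interface the bookkeeping uses: Frobenius reciprocity in existence form (`Hom_M(r_P I', ℂ_χ) ≠ 0 ⇒ Hom_G(I', I) ≠ 0`,
and symmetrically) and uniqueness form (`Hom_M(r_P I, ℂ_χ)` a line ⇒ `End_G(I)` a line, and symmetrically), the non-vanishing of the Jacquet image of every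
non-zero subrepresentation (evaluation at one), the two Jacquet filtrations (`r_P I` two-dimensional with a `χ'`-line and quotient `χ`; `r_P I'` with a
`χ`-line and quotient `χ'`), and «no constituent of `I'` has zero Jacquet module».  Stated abstractly so that consumers instantiate it SYNTACTICALLY at
their own spelling of the principal series (for `U(3)`: ★ `cmPrincipalSeries`); `isConstituentOf_normalizedInd_of_weylData` below is the instance
`I = i_P^G(χ)`, `I' = i_P^G(χ')`. [cite: Casselman1995, §7.1 Cor. 7.1.2] [cite: BernsteinZelevinsky1977, Thm. 2.9] [cite: Rogawski1990, §12.2 p. 174] -/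
theorem isConstituentOf_of_weylData (hN : IsLimitOfCompactOpen t.N) (hcomm : ∀ m m' : ↥t.M, m * m' = m' * m)
    (χ χ' : ↥t.M →* ℂˣ) (hne : χ ≠ χ')
    {V V' : Type*} [AddCommGroup V] [Module ℂ V] [AddCommGroup V'] [Module ℂ V']
    (I : Representation ℂ G V) (I' : Representation ℂ G V') (hsm' : I'.IsSmooth)
    (hFrob : ∀ φ : (I'.normalizedJacquet t).IntertwiningMap ((Representation.trivial ℂ ↥t.M ℂ).twist χ), φ ≠ 0 →
      ∃ B : I'.IntertwiningMap I, B ≠ 0)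
    (hFrob' : ∀ φ : (I.normalizedJacquet t).IntertwiningMap ((Representation.trivial ℂ ↥t.M ℂ).twist χ'), φ ≠ 0 →
      ∃ A : I.IntertwiningMap I', A ≠ 0)
    (hUniq : (∀ ψ₁ ψ₂ : (I.normalizedJacquet t).IntertwiningMap ((Representation.trivial ℂ ↥t.M ℂ).twist χ), ψ₁ ≠ 0 → ∃ c : ℂ, ψ₂ = c • ψ₁) →
      ∀ B₁ B₂ : I.IntertwiningMap I, B₁ ≠ 0 → ∃ c : ℂ, B₂ = c • B₁)
    (hUniq' : (∀ ψ₁ ψ₂ : (I'.normalizedJacquet t).IntertwiningMap ((Representation.trivial ℂ ↥t.M ℂ).twist χ'), ψ₁ ≠ 0 → ∃ c : ℂ, ψ₂ = c • ψ₁) →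
      ∀ B₁ B₂ : I'.IntertwiningMap I', B₁ ≠ 0 → ∃ c : ℂ, B₂ = c • B₁)
    (hev : ∀ F : Subrepresentation I, F ≠ ⊥ → ∃ f ∈ F, Representation.Coinvariants.mk (t.restrict I) f ≠ 0)
    (hev' : ∀ F : Subrepresentation I', F ≠ ⊥ → ∃ f ∈ F, Representation.Coinvariants.mk (t.restrict I') f ≠ 0)
    (hJ : FiniteDimensional ℂ (t.restrict I).Coinvariants ∧ Module.finrank ℂ (t.restrict I).Coinvariants = 2 ∧
      ∃ ℓ : Submodule ℂ (t.restrict I).Coinvariants, Module.finrank ℂ ↥ℓ = 1 ∧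
        (∀ (m : ↥t.M), ∀ x ∈ ℓ, I.normalizedJacquet t m x = ((χ' m : ℂˣ) : ℂ) • x) ∧
        (∀ (m : ↥t.M) x, I.normalizedJacquet t m x - ((χ m : ℂˣ) : ℂ) • x ∈ ℓ))
    (hJ' : FiniteDimensional ℂ (t.restrict I').Coinvariants ∧ Module.finrank ℂ (t.restrict I').Coinvariants = 2 ∧
      ∃ ℓ : Submodule ℂ (t.restrict I').Coinvariants, Module.finrank ℂ ↥ℓ = 1 ∧
        (∀ (m : ↥t.M), ∀ x ∈ ℓ, I'.normalizedJacquet t m x = ((χ m : ℂˣ) : ℂ) • x) ∧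
        (∀ (m : ↥t.M) x, I'.normalizedJacquet t m x - ((χ' m : ℂˣ) : ℂ) • x ∈ ℓ))
    (hNC : ∀ r : SmoothIrrep G, (IrrClass.mk r).IsConstituentOf I' → Subsingleton (t.restrict r.ρ).Coinvariants → False)
    {c : IrrClass G} (hc : c.IsConstituentOf I') : c.IsConstituentOf I := by
  obtain ⟨hfd, hX2, ℓ, hℓ1, hℓχ', hqχ⟩ := hJ
  obtain ⟨hfd', hX2', ℓ', hℓ'1, hℓ'χ, hqχ'⟩ := hJ'
  -- Step 1: non-zero `M`-maps `r I' → ℂ_χ` and `r I → ℂ_χ'`, hence `B : I' → I`, `A : I → I'`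
  obtain ⟨φB, hφB⟩ := exists_intertwiningMap_character_of_line hcomm _ χ χ' hne ℓ' hℓ'1 hℓ'χ hqχ'
  obtain ⟨φA, hφA⟩ := exists_intertwiningMap_character_of_line hcomm _ χ' χ hne.symm ℓ hℓ1 hℓχ' hqχ
  obtain ⟨B, hB⟩ := hFrob φB hφB
  obtain ⟨A, hA⟩ := hFrob' φA hφA
  -- Step 2: `End(I) = ℂ`, `End(I') = ℂ`: `BA = a`, `AB = a'`
  have huniq := fun ψ₁ ψ₂ h₁ => intertwiningMap_character_eq_smul (I.normalizedJacquet t) hX2 χ' χ hne.symm ℓ hℓ1 hℓχ' ψ₁ ψ₂ h₁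
  have huniq' := fun ψ₁ ψ₂ h₁ => intertwiningMap_character_eq_smul (I'.normalizedJacquet t) hX2' χ χ' hne ℓ' hℓ'1 hℓ'χ ψ₁ ψ₂ h₁
  have hid : Representation.IntertwiningMap.id I ≠ 0 := id_ne_zero_of_nontrivial_coinvariants t I (Module.nontrivial_of_finrank_eq_succ hX2)
  have hid' : Representation.IntertwiningMap.id I' ≠ 0 := id_ne_zero_of_nontrivial_coinvariants t I' (Module.nontrivial_of_finrank_eq_succ hX2')
  obtain ⟨a, ha⟩ := hUniq huniq (Representation.IntertwiningMap.id _) (B.comp A) hid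
  obtain ⟨a', ha'⟩ := hUniq' huniq' (Representation.IntertwiningMap.id _) (A.comp B) hid'
  have hBA' : ∀ y, B (A y) = a • y := fun y => by
    have h := congrArg (fun T : Representation.IntertwiningMap _ _ => T y) ha
    simpa [Representation.IntertwiningMap.comp_apply, Representation.IntertwiningMap.smul_apply] using h
  have hAB' : ∀ x, A (B x) = a' • x := fun x => by
    have h := congrArg (fun T : Representation.IntertwiningMap _ _ => T x) ha'
    simpa [Representation.IntertwiningMap.comp_apply, Representation.IntertwiningMap.smul_apply] using h
  -- Step 3: either `B` is injective, or `AB = 0 = BA`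
  by_cases hBinj : Function.Injective B
  · exact hc.of_injective B hBinj
  have ha'0 : a' = 0 := by
    by_contra h
    apply hBinj
    intro x y hxy
    have h2 := congrArg A hxy
    rw [hAB', hAB'] at h2
    exact smul_right_injective _ h h2
  have hAB : ∀ x, A (B x) = 0 := fun x => by rw [hAB', ha'0, zero_smul]
  have ha0 : a = 0 := by
    by_contra h
    apply hB
    apply Representation.IntertwiningMap.ext
    apply LinearMap.ext
    intro x
    have h1 := hBA' (B x)
    rw [hAB, map_zero] at h1
    exact (smul_eq_zero.1 h1.symm).resolve_left h
  have hBA : ∀ y, B (A y) = 0 := fun y => by rw [hBA', ha0, zero_smul]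
  have hF : A.range ≤ B.ker := by
    rintro x ⟨y, rfl⟩
    exact (Representation.IntertwiningMap.mem_ker _ _ B _).2 (hBA y)
  -- Step 4: `im A` and `ker B` have the SAME one-dimensional image in `r I'`
  have hArange : A.range ≠ ⊥ := by
    intro h
    apply hA
    apply Representation.IntertwiningMap.ext
    apply LinearMap.ext
    intro v
    have hv : A v ∈ A.range := ⟨v, rfl⟩
    rw [h] at hv
    exact (Submodule.mem_bot ℂ).1 hv
  have hBrange : B.range ≠ ⊥ := by
    intro h
    apply hB
    apply Representation.IntertwiningMap.ext
    apply LinearMap.ext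
    intro v
    have hv : B v ∈ B.range := ⟨v, rfl⟩
    rw [h] at hv
    exact (Submodule.mem_bot ℂ).1 hv
  have hXle : A.range.toSubmodule.map (Representation.Coinvariants.mk (t.restrict I')) ≤
      B.ker.toSubmodule.map (Representation.Coinvariants.mk (t.restrict I')) := Submodule.map_mono hF
  -- (a) the image of `im A` is non-zero
  have hX₁ : A.range.toSubmodule.map (Representation.Coinvariants.mk (t.restrict I')) ≠ ⊥ := by
    obtain ⟨f₁, hf₁mem, hf₁⟩ := hev' A.range hArange
    intro h
    have hmem : Representation.Coinvariants.mk _ f₁ ∈ A.range.toSubmodule.map (Representation.Coinvariants.mk (t.restrict I')) :=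
      ⟨f₁, hf₁mem, rfl⟩
    rw [h, Submodule.mem_bot] at hmem
    exact hf₁ hmem
  -- (b) the image of `ker B` is not everything (else `im B ≠ 0` would die in `r I`)
  have hX₂ : B.ker.toSubmodule.map (Representation.Coinvariants.mk (t.restrict I')) ≠ ⊤ := by
    intro htop
    obtain ⟨w, ⟨f, rfl⟩, hw⟩ := hev B.range hBrange
    have hf : Representation.Coinvariants.mk _ f ∈ B.ker.toSubmodule.map (Representation.Coinvariants.mk (t.restrict I')) := by
      rw [htop]; trivial
    obtain ⟨f₂, hf₂, hf₂eq⟩ := Submodule.mem_map.1 hf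
    have hBf₂ : B f₂ = 0 := (Representation.IntertwiningMap.mem_ker _ _ B f₂).1 hf₂
    have h1 : Representation.jacquetMap t B (Representation.Coinvariants.mk _ f) = 0 := by
      rw [← hf₂eq, Representation.jacquetMap_mk, hBf₂, map_zero]
    rw [Representation.jacquetMap_mk] at h1
    exact hw h1
  -- (c) so both images are the same line
  haveI := hfd'
  have heq : A.range.toSubmodule.map (Representation.Coinvariants.mk (t.restrict I')) =
      B.ker.toSubmodule.map (Representation.Coinvariants.mk (t.restrict I')) := by
    apply Submodule.eq_of_le_of_finrank_eq hXle
    have h1 : Module.finrank ℂ ↥(A.range.toSubmodule.map (Representation.Coinvariants.mk (t.restrict I'))) ≠ 0 :=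
      fun h => hX₁ (Submodule.finrank_eq_zero.1 h)
    have h2 := Submodule.finrank_lt hX₂
    rw [hX2'] at h2
    have h3 := Submodule.finrank_mono hXle
    omega
  -- Step 5: chase
  exact isConstituentOf_of_comp_eq_zero t hN hsm' A B
    (subsingleton_coinvariants_quotient_of_map_eq t hN hsm' A.range B.ker hF heq) hNC hc

/-- **THE RANK-ONE WEYL THEOREM for `i_P^G` (one inclusion): every constituent of `i(χ')` is a constituent of `i(χ)`** — the abstract theorem at
`I = i_P^G(χ)`, `I' = i_P^G(χ')` (`δ_P|_N = 1`), the Frobenius and evaluation-at-one inputs being ★ (file 1/4 §2, §5).  Hypotheses: `M` commutative,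
`χ ≠ χ'`, the two Jacquet filtrations (the geometric lemma), and no constituent of `i(χ')` with zero Jacquet module.
«`i_G(χ)` and `i_G(wχ)` have the same sets of constituents» [Rogawski1990, §12.2 p. 174].
[cite: Casselman1995, §7.1 Cor. 7.1.2] [cite: BernsteinZelevinsky1977, Thm. 2.9] [cite: Rogawski1990, §12.2 p. 174] -/
theorem isConstituentOf_normalizedInd_of_weylData
    (hδ : ∀ (n : G) (hn : n ∈ t.N), deltaChar t.P ⟨n, t.N_le hn⟩ = 1) (hN : IsLimitOfCompactOpen t.N)
    (hcomm : ∀ m m' : ↥t.M, m * m' = m' * m) (χ χ' : ↥t.M →* ℂˣ) (hne : χ ≠ χ')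
    (hJ : FiniteDimensional ℂ (t.restrict (Representation.normalizedInd t ((Representation.trivial ℂ ↥t.M ℂ).twist χ))).Coinvariants ∧
      Module.finrank ℂ (t.restrict (Representation.normalizedInd t ((Representation.trivial ℂ ↥t.M ℂ).twist χ))).Coinvariants = 2 ∧
      ∃ ℓ : Submodule ℂ (t.restrict (Representation.normalizedInd t ((Representation.trivial ℂ ↥t.M ℂ).twist χ))).Coinvariants,
        Module.finrank ℂ ↥ℓ = 1 ∧
        (∀ (m : ↥t.M), ∀ x ∈ ℓ, (Representation.normalizedInd t ((Representation.trivial ℂ ↥t.M ℂ).twist χ)).normalizedJacquet t m x =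
          ((χ' m : ℂˣ) : ℂ) • x) ∧
        (∀ (m : ↥t.M) x, (Representation.normalizedInd t ((Representation.trivial ℂ ↥t.M ℂ).twist χ)).normalizedJacquet t m x -
          ((χ m : ℂˣ) : ℂ) • x ∈ ℓ))
    (hJ' : FiniteDimensional ℂ (t.restrict (Representation.normalizedInd t ((Representation.trivial ℂ ↥t.M ℂ).twist χ'))).Coinvariants ∧
      Module.finrank ℂ (t.restrict (Representation.normalizedInd t ((Representation.trivial ℂ ↥t.M ℂ).twist χ'))).Coinvariants = 2 ∧
      ∃ ℓ : Submodule ℂ (t.restrict (Representation.normalizedInd t ((Representation.trivial ℂ ↥t.M ℂ).twist χ'))).Coinvariants,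
        Module.finrank ℂ ↥ℓ = 1 ∧
        (∀ (m : ↥t.M), ∀ x ∈ ℓ, (Representation.normalizedInd t ((Representation.trivial ℂ ↥t.M ℂ).twist χ')).normalizedJacquet t m x =
          ((χ m : ℂˣ) : ℂ) • x) ∧
        (∀ (m : ↥t.M) x, (Representation.normalizedInd t ((Representation.trivial ℂ ↥t.M ℂ).twist χ')).normalizedJacquet t m x -
          ((χ' m : ℂˣ) : ℂ) • x ∈ ℓ))
    (hNC : ∀ r : SmoothIrrep G,
      (IrrClass.mk r).IsConstituentOf (Representation.normalizedInd t ((Representation.trivial ℂ ↥t.M ℂ).twist χ')) →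
        Subsingleton (t.restrict r.ρ).Coinvariants → False)
    {c : IrrClass G} (hc : c.IsConstituentOf (Representation.normalizedInd t ((Representation.trivial ℂ ↥t.M ℂ).twist χ'))) :
    c.IsConstituentOf (Representation.normalizedInd t ((Representation.trivial ℂ ↥t.M ℂ).twist χ)) := by
  have hsm : (Representation.normalizedInd t ((Representation.trivial ℂ ↥t.M ℂ).twist χ)).IsSmooth :=
    Representation.isSmooth_smoothInd t.P _
  have hsm' : (Representation.normalizedInd t ((Representation.trivial ℂ ↥t.M ℂ).twist χ')).IsSmooth :=
    Representation.isSmooth_smoothInd t.P _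
  obtain ⟨ev, hev, -⟩ := F0P2pJacquetConstituentLemmas.exists_evalOne_coinvariants t χ hδ
  obtain ⟨ev', hev', -⟩ := F0P2pJacquetConstituentLemmas.exists_evalOne_coinvariants t χ' hδ
  refine isConstituentOf_of_weylData t hN hcomm χ χ' hne _ _ hsm'
    (fun φ hφ => F0P2pJacquetConstituentLemmas.exists_intertwiningMap_normalizedInd_ne_zero t hδ _ hsm' χ φ hφ)
    (fun φ hφ => F0P2pJacquetConstituentLemmas.exists_intertwiningMap_normalizedInd_ne_zero t hδ _ hsm χ' φ hφ)
    (F0P2pJacquetConstituentLemmas.intertwiningMap_normalizedInd_eq_smul t hδ _ hsm χ)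
    (F0P2pJacquetConstituentLemmas.intertwiningMap_normalizedInd_eq_smul t hδ _ hsm' χ')
    (fun F hF => ?_) (fun F hF => ?_) hJ hJ' hNC hc
  · obtain ⟨f, hf, hf1⟩ := F0P2pJacquetConstituentLemmas.exists_mem_toFun_one_ne_zero_of_ne_bot t χ F hF
    exact ⟨f, hf, fun h0 => hf1 (by rw [← hev f, h0, map_zero])⟩
  · obtain ⟨f, hf, hf1⟩ := F0P2pJacquetConstituentLemmas.exists_mem_toFun_one_ne_zero_of_ne_bot t χ' F hF
    exact ⟨f, hf, fun h0 => hf1 (by rw [← hev' f, h0, map_zero])⟩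

end Main


end Summit.HodgeConjecture.HodgeConjecture.Cruxes.H413.F0P2pWeylConstituentsRankOne

end
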